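import Summits.BirchSwinnertonDyer.Rank1Residual.Supersingular.MazurTateHeckeDescentLayerZero
import HarnessLib

/-!
# The trivial-character column of the Mazur–Tate elements in CLOSED FORM: `θ_n(0) = e_n·[0]⁺_f` at
# every layer and any good odd prime via the Hecke descent sequence; the `a_p = 0` and X8 tables
# (cell `b2b-bsdres`, supersingular family, prover B = unit `b2b-bsdres-additive-p3`, gen 11; part 1)

HONEST FRAMING (run/shared/lean/b2b/bsd-rank1-residual/, verbatim in every file): the goal of the
cell is to DELETE the COMBINATION-SHAPED residual classes of the Birch–Swinnerton-Dyer formula for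
ALL analytic-rank `≤ 1` elliptic curves over `ℚ` — "full BSD formula for every rank `≤ 1` curve in
class `C`" assembled STRICTLY from published theorems — so that the rank-`≤ 1` remainder becomes
exactly the CONSTRUCTION-SHAPED classes, which are TYPED (missing-input `Prop`s), NOT attempted.
This is not "finishing BSD". THEOREMS ONLY (no definition, no named fact, no `sorry`): elementary
algebra over the tree's REAL objects (`θ_n = mazurTateElement f p n`, `[0]⁺_f = ratPlusSymbol f 0`);
nothing about any particular curve is asserted; nothing is booked; X8 / X7 / X6 stay CONSTRUCTION-SHAPED.

## What this file proves, and why (memo `HOME/b2b-bsdres-additive-p3/X8-ROUTE-B.md` §16)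

Gen 9 (`MazurTateHeckeDescentLayerZero.lean`) had the base values `θ_0(0) = (a_p − 2)[0]⁺_f`,
`θ_1(0) = (a_p² − 2a_p − p + 1)[0]⁺_f` and the recursion `θ_{m+2}(0) = a_p θ_{m+1}(0) − p θ_m(0)`
(the three-term relation at `ζ = 1`), used only for `[0]⁺ = 0 ⇒ θ_n(0) = 0` and for the X8 forced
zero `θ_n(0) = 0`, `n ≡ 2 (mod 6)`, `a_3 = +3`. Here the column is SOLVED:
* §1–§2 **`θ_{n+1}(0) = (c_{n+2} − 2c_{n+1} + c_n)·[0]⁺_f` for every `n`** (`θ_0(0) = (c_1 − 2c_0)[0]⁺`),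
  `c` the Hecke descent sequence `c_0 = 1, c_1 = a_p, c_{j+2} = a_p c_{j+1} − p c_j` (gen 9, carried
  as hypotheses) — the second difference `e_n = (αⁿ(α−1)² − βⁿ(β−1)²)/(α−β)` of the Lucas sequence
  (`eval₂_mazurTateElement_succ_at_zero`, `eval_zero_mazurTateElement_succ`): ANY rational newform,
  ANY prime `p ∤ 2N`. Supersingular `p ∣ a_p`: `p ∣ c_j` (`j ≥ 1`), so `e_0 = a_p − 2` and
  `e_1 ≡ 1 (mod p)` are `p`-units (`p` odd) while **`p ∣ e_n` for every `n ≥ 2`**.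
* §3 **`a_p = 0`** (X6/X7; every supersingular `p ≥ 5`): **`θ_{2i}(0) = −2(−p)^i[0]⁺`,
  `θ_{2i+1}(0) = (1−p)(−p)^i[0]⁺`**; **X8 (`p = 3`, `a_3 = ±3`)**: `θ_n(0)/[0]⁺ = a_3 − 2, 7 − 2a_3,
  4a_3 − 12, 15 − 6a_3, 3a_3 − 18, −18` for `n = 0..5` and **`θ_{n+6}(0) = −27·θ_n(0)`**, i.e.
  `(1, 1, 0, −3, −9, −18)` at `a_3 = 3`, `(−5, 13, −24, 33, −27, −18)` at `a_3 = −3`; gen 9's forced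
  zero is the ONLY one: **`θ_n(0) = 0 ⟺ a_3 = 3 ∧ n ≡ 2 (mod 6)`** (for `L(f,1) ≠ 0`).
Part 2 (`MazurTateConstantTermsMu.lean`): the exact valuation `ord_p θ_n(0) = ⌊n/2⌋ + ord_p[0]⁺` at
`a_p = 0`, the rank-zero bounds `μ(Θ_n) ≤ ord_p θ_n(0)`, `μ(L^•) ≤ ord_p(c_•[0]⁺)`, and the UNIT case
(`ord_p[0]⁺ = 0 ⇒ L^• ∈ Λ^×`, Kurihara's pattern `λ(θ_n) = q_n`) on real objects.

For iw-2 / hyp: an exact per-row column `e_n` for every `p = 3` supersingular table (hyp SC §61 (c)'s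
`U_3 = (a_3−1)(a_3−3)(a_3+2)·S_0` is `e_2 = a³ − 2a² − 5a + 6` at `p = 3`). Analytic side only.

References: B. Mazur, J. Tate, J. Teitelbaum, Invent. Math. 84 (1986) §I.4 (4.2), §I.8 (8.6), §I.10
(10.2) [MazurTateTeitelbaum1986Invent]; R. Pollack, Duke Math. J. 118 (2003) Prop. 6.9–6.10
[Pollack2003]. Memo: `HOME/b2b-bsdres-additive-p3/X8-ROUTE-B.md` §16 (gen 11).
-/

set_option autoImplicit false

noncomputable section

open scoped Classical MatrixGroups ModularForm

open CongruenceSubgroup Polynomial WeierstrassCurve Literature.NumberTheory.EllipticCurves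
  Literature.NumberTheory.EllipticCurves.ModularForms
  Literature.NumberTheory.EllipticCurves.Sprung2017
  Literature.NumberTheory.EllipticCurves.Rank1Residual
  Summit.BirchSwinnertonDyer.Rank1Residual.X1.MuLambda
  Summit.BirchSwinnertonDyer.Rank1Residual.Iwasawa

namespace Summit.BirchSwinnertonDyer.Rank1Residual.Supersingular

/-! ## §1. The second difference `e_{n+1} = c_{n+2} − 2c_{n+1} + c_n` of the Hecke descent sequence -/

section SecondDifference

/-- The second difference of the Hecke descent sequence solves the same recursion:
`e_{m+3} = a_p e_{m+2} − p e_{m+1}` where `e_{k+1} = c_{k+2} − 2c_{k+1} + c_k`. [folklore] -/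
theorem heckeDescentSeq_secondDiff_rec {ap : ℤ} {p : ℕ} {c : ℕ → ℤ}
    (hrec : ∀ j, c (j + 2) = ap * c (j + 1) - p * c j) (m : ℕ) :
    c (m + 4) - 2 * c (m + 3) + c (m + 2) =
      ap * (c (m + 3) - 2 * c (m + 2) + c (m + 1)) - p * (c (m + 2) - 2 * c (m + 1) + c m) := by
  have h2 : c (m + 4) = ap * c (m + 3) - p * c (m + 2) := by
    rw [show m + 4 = (m + 2) + 2 by ring, hrec, show m + 2 + 1 = m + 3 by ring]
  have h1 : c (m + 3) = ap * c (m + 2) - p * c (m + 1) := by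
    rw [show m + 3 = (m + 1) + 2 by ring, hrec, show m + 1 + 1 = m + 2 by ring]
  have h0 : c (m + 2) = ap * c (m + 1) - p * c m := hrec m
  linear_combination h2 - 2 * h1 + h0

/-- **Supersingular regime `p ∣ a_p`: `p ∣ c_j` for every `j ≥ 1`** (`c_j ≡ a_p^j ≡ 0`). [folklore] -/
theorem heckeDescentSeq_dvd_succ_of_dvd {ap : ℤ} {p : ℕ} {c : ℕ → ℤ} (hc0 : c 0 = 1)
    (hc1 : c 1 = ap) (hrec : ∀ j, c (j + 2) = ap * c (j + 1) - p * c j) (hap : (p : ℤ) ∣ ap)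
    (j : ℕ) : (p : ℤ) ∣ c (j + 1) := by
  have h := heckeDescentSeq_intCast_zmod_eq_pow hc0 hc1 hrec (j + 1)
  rw [(ZMod.intCast_zmod_eq_zero_iff_dvd ap p).mpr hap, zero_pow (Nat.succ_ne_zero j)] at h
  exact (ZMod.intCast_zmod_eq_zero_iff_dvd _ p).mp h

/-- Supersingular regime: **`p ∣ e_n` for every `n ≥ 2`** (`e_{n} = c_{n+1} − 2c_n + c_{n−1}`, all three
terms divisible by `p`). [folklore] -/
theorem heckeDescentSeq_dvd_secondDiff_of_dvd {ap : ℤ} {p : ℕ} {c : ℕ → ℤ} (hc0 : c 0 = 1)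
    (hc1 : c 1 = ap) (hrec : ∀ j, c (j + 2) = ap * c (j + 1) - p * c j) (hap : (p : ℤ) ∣ ap)
    (n : ℕ) : (p : ℤ) ∣ c (n + 3) - 2 * c (n + 2) + c (n + 1) :=
  ((heckeDescentSeq_dvd_succ_of_dvd hc0 hc1 hrec hap (n + 2)).sub
    ((heckeDescentSeq_dvd_succ_of_dvd hc0 hc1 hrec hap (n + 1)).mul_left 2)).add
    (heckeDescentSeq_dvd_succ_of_dvd hc0 hc1 hrec hap n)

/-- Supersingular regime: **`e_1 = c_2 − 2c_1 + c_0 ≡ 1 (mod p)`**, so for a prime `p` it is a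
`p`-adic unit. [folklore] -/
theorem not_dvd_heckeDescentSeq_secondDiff_one_of_dvd {ap : ℤ} {p : ℕ} [hp : Fact p.Prime]
    {c : ℕ → ℤ} (hc0 : c 0 = 1) (hc1 : c 1 = ap)
    (hrec : ∀ j, c (j + 2) = ap * c (j + 1) - p * c j) (hap : (p : ℤ) ∣ ap) :
    ¬ (p : ℤ) ∣ c 2 - 2 * c 1 + c 0 := by
  intro h
  have h2 : (p : ℤ) ∣ c 2 := heckeDescentSeq_dvd_succ_of_dvd hc0 hc1 hrec hap 1
  have h1 : (p : ℤ) ∣ c 1 := heckeDescentSeq_dvd_succ_of_dvd hc0 hc1 hrec hap 0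
  have h3 : (p : ℤ) ∣ 1 := by
    have e : (1 : ℤ) = (c 2 - 2 * c 1 + c 0) - c 2 + 2 * c 1 := by rw [hc0]; ring
    rw [e]
    exact (h.sub h2).add (h1.mul_left 2)
  exact hp.out.ne_one (by exact_mod_cast Int.eq_one_of_dvd_one (Int.natCast_nonneg p) h3)

/-- Supersingular regime at an ODD prime: **`e_0 = a_p − 2` is a `p`-adic unit**. [folklore] -/
theorem not_dvd_sub_two_of_dvd {ap : ℤ} {p : ℕ} [hp : Fact p.Prime] (hp2 : p ≠ 2)
    (hap : (p : ℤ) ∣ ap) : ¬ (p : ℤ) ∣ ap - 2 := by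
  intro h
  have h2 : (p : ℤ) ∣ 2 := by simpa using hap.sub h
  have : p ∣ 2 := by exact_mod_cast h2
  exact hp2 ((Nat.prime_dvd_prime_iff_eq hp.out Nat.prime_two).mp this)

/-- **`a_p = 0`: the second differences in closed form** — `e_{2i+1} = (1 − p)(−p)^i` and
`e_{2i+2} = −2(−p)^{i+1}` (with `e_0 = −2`). [folklore] -/
theorem heckeDescentSeq_secondDiff_of_ap_eq_zero {p : ℕ} {c : ℕ → ℤ} (hc0 : c 0 = 1)
    (hc1 : c 1 = 0) (hrec : ∀ j, c (j + 2) = 0 * c (j + 1) - p * c j) (i : ℕ) :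
    c (2 * i + 2) - 2 * c (2 * i + 1) + c (2 * i) = (1 - p) * (-(p : ℤ)) ^ i ∧
      c (2 * i + 3) - 2 * c (2 * i + 2) + c (2 * i + 1) = -2 * (-(p : ℤ)) ^ (i + 1) := by
  obtain ⟨h0, h1⟩ := heckeDescentSeq_of_ap_eq_zero hc0 hc1 hrec i
  obtain ⟨h2, h3⟩ := heckeDescentSeq_of_ap_eq_zero hc0 hc1 hrec (i + 1)
  rw [show 2 * (i + 1) = 2 * i + 2 by ring] at h2
  rw [show 2 * (i + 1) + 1 = 2 * i + 3 by ring] at h3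
  refine ⟨?_, ?_⟩
  · rw [h2, h1, h0, pow_succ]; ring
  · rw [h3, h2, h1, pow_succ]; ring

/-- **X8 (`p = 3`, `a_3² = 9`): the second differences** `e_1, …, e_6 = 7 − 2a_3, 4a_3 − 12,
15 − 6a_3, 3a_3 − 18, −18, 54 − 27a_3` (`e_0 = a_3 − 2`). [folklore] -/
theorem heckeDescentSeq_secondDiff_values_of_three {a : ℤ} (ha : a ^ 2 = 9) {c : ℕ → ℤ}
    (hc0 : c 0 = 1) (hc1 : c 1 = a) (hrec : ∀ j, c (j + 2) = a * c (j + 1) - (3 : ℕ) * c j) :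
    c 2 - 2 * c 1 + c 0 = 7 - 2 * a ∧ c 3 - 2 * c 2 + c 1 = 4 * a - 12 ∧
      c 4 - 2 * c 3 + c 2 = 15 - 6 * a ∧ c 5 - 2 * c 4 + c 3 = 3 * a - 18 ∧
      c 6 - 2 * c 5 + c 4 = -18 ∧ c 7 - 2 * c 6 + c 5 = 54 - 27 * a := by
  obtain ⟨h2, h3, h4, h5, h6, h7⟩ := heckeDescentSeq_values_of_three ha hc0 hc1 hrec
  rw [h2, h3, h4, h5, h6, h7, hc1, hc0]
  refine ⟨by ring, by ring, by ring, by ring, by ring, by ring⟩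

/-- **X8: the period-six law for the second differences**, `e_{n+7} = −27·e_{n+1}`
(and `e_6 = 54 − 27a_3 = −27·e_0`). [folklore] -/
theorem heckeDescentSeq_secondDiff_add_six_of_three {a : ℤ} (ha : a ^ 2 = 9) {c : ℕ → ℤ}
    (hc0 : c 0 = 1) (hc1 : c 1 = a) (hrec : ∀ j, c (j + 2) = a * c (j + 1) - (3 : ℕ) * c j)
    (n : ℕ) : c (n + 8) - 2 * c (n + 7) + c (n + 6) = -27 * (c (n + 2) - 2 * c (n + 1) + c n) := by
  rw [show n + 8 = (n + 2) + 6 by ring, show n + 7 = (n + 1) + 6 by ring,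
    heckeDescentSeq_add_six_of_three ha hc0 hc1 hrec, heckeDescentSeq_add_six_of_three ha hc0 hc1 hrec,
    heckeDescentSeq_add_six_of_three ha hc0 hc1 hrec]
  ring

end SecondDifference

/-! ## §2. The trivial-character column in closed form: `θ_{n+1}(0) = e_{n+1}·[0]⁺_f` -/

section ClosedForm

variable {N : ℕ} [NeZero N] {f : CuspForm (Gamma0 N) 2} {p : ℕ} [hp : Fact p.Prime]

/-- **`θ_{n+1}(0) = (c_{n+2} − 2c_{n+1} + c_n)·[0]⁺_f` for every `n`** (`f` a rational newform,
`p ∤ 2N`, `a_p(f) = a_p`, `c` the Hecke descent sequence): the values `θ_m(0) = ∑_a [a/p^{m+1}]⁺`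
solve `θ_{m+2}(0) = a_p θ_{m+1}(0) − p θ_m(0)` (three-term relation at `ζ = 1`, `Φ_{p^{m+1}}(1) = p`)
from `θ_0(0) = (a_p − 2)[0]⁺`, `θ_1(0) = (a_p² − 2a_p − p + 1)[0]⁺`, and so does the second difference
of `c`; the initial values agree. (`e_n = (αⁿ(α−1)² − βⁿ(β−1)²)/(α − β)`, the classical multiplier.)
[cite: MazurTateTeitelbaum1986Invent, §I.8 (8.6) and §I.10 Prop. (10.2)] -/
theorem eval₂_mazurTateElement_succ_at_zero (hp2 : p ≠ 2) (hf0 : IsNewform0 f)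
    (hQ : coeffField f = ⊥) (hpN : ¬ p ∣ N) {ap : ℤ} (hap : cuspCoeff f p = ap) {c : ℕ → ℤ}
    (hc0 : c 0 = 1) (hc1 : c 1 = ap) (hrec : ∀ j, c (j + 2) = ap * c (j + 1) - p * c j) (n : ℕ) :
    (mazurTateElement f p (n + 1)).eval₂ (algebraMap ℚ ℂ_[p]) 0 =
      algebraMap ℚ ℂ_[p] (((c (n + 2) - 2 * c (n + 1) + c n : ℤ) : ℚ) * ratPlusSymbol f 0) := by
  set t : ℕ → ℂ_[p] := fun m ↦ (mazurTateElement f p m).eval₂ (algebraMap ℚ ℂ_[p]) 0 with ht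
  set r : ℚ := ratPlusSymbol f 0 with hr
  have hstep : ∀ m, t (m + 2) = (ap : ℂ_[p]) * t (m + 1) - (p : ℂ_[p]) * t m := by
    intro m
    have h := eval₂_mazurTateElement_threeTerm hf0 hQ hpN hap m (ζ := 1) (one_pow _)
    rw [eval_cyclotomic_prime_pow_succ_of_pow_eq_one (one_pow _), sub_self] at h
    exact h
  have h0 : t 0 = algebraMap ℚ ℂ_[p] (((ap : ℚ) - 2) * r) :=
    eval₂_mazurTateElement_zero_at_zero hp2 hf0 hQ hpN hap
  have h1 : t 1 = algebraMap ℚ ℂ_[p] ((((ap : ℚ)) ^ 2 - 2 * ap - p + 1) * r) :=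
    eval₂_mazurTateElement_one_at_zero hp2 hf0 hQ hpN hap
  have hc2 : c 2 = ap * ap - p * 1 := by rw [hrec 0, zero_add, hc1, hc0]
  have hc3 : c 3 = ap * c 2 - p * ap := by rw [show (3 : ℕ) = 1 + 2 by rfl, hrec 1, hc1]
  have cast_step : ∀ m, (ap : ℂ_[p]) * algebraMap ℚ ℂ_[p]
        (((c (m + 3) - 2 * c (m + 2) + c (m + 1) : ℤ) : ℚ) * r) -
      (p : ℂ_[p]) * algebraMap ℚ ℂ_[p] (((c (m + 2) - 2 * c (m + 1) + c m : ℤ) : ℚ) * r) =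
      algebraMap ℚ ℂ_[p] (((c (m + 4) - 2 * c (m + 3) + c (m + 2) : ℤ) : ℚ) * r) := by
    intro m
    rw [heckeDescentSeq_secondDiff_rec hrec m, ← map_intCast (algebraMap ℚ ℂ_[p]) ap,
      ← map_natCast (algebraMap ℚ ℂ_[p]) p, ← map_mul, ← map_mul, ← map_sub]
    congr 1
    push_cast
    ring
  have key : ∀ m, t (m + 1) = algebraMap ℚ ℂ_[p] (((c (m + 2) - 2 * c (m + 1) + c m : ℤ) : ℚ) * r) ∧
      t (m + 2) = algebraMap ℚ ℂ_[p] (((c (m + 3) - 2 * c (m + 2) + c (m + 1) : ℤ) : ℚ) * r) := by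
    intro m
    induction m with
    | zero =>
      refine ⟨?_, ?_⟩
      · rw [zero_add, h1, hc2, hc1, hc0]
        congr 1
        push_cast
        ring
      · rw [zero_add, hstep 0, zero_add, h1, h0, hc3, hc2, hc1, ← map_intCast (algebraMap ℚ ℂ_[p]) ap,
          ← map_natCast (algebraMap ℚ ℂ_[p]) p, ← map_mul, ← map_mul, ← map_sub]
        congr 1
        push_cast
        ring
    | succ m ih =>
      refine ⟨by rw [show m + 1 + 1 = m + 2 by ring]; exact ih.2, ?_⟩
      rw [show m + 1 + 2 = (m + 1) + 2 by ring, hstep (m + 1), show m + 1 + 1 = m + 2 by ring, ih.2,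
        ih.1, cast_step m]
  exact (key n).1

/-- The base layer in the same shape: `θ_0(0) = (c_1 − 2c_0)·[0]⁺_f` (`= (a_p − 2)[0]⁺_f`, gen 9).
[cite: MazurTateTeitelbaum1986Invent, §I.4 (4.2) and §I.8 (8.6)] -/
theorem eval₂_mazurTateElement_zero_at_zero' (hp2 : p ≠ 2) (hf0 : IsNewform0 f)
    (hQ : coeffField f = ⊥) (hpN : ¬ p ∣ N) {ap : ℤ} (hap : cuspCoeff f p = ap) {c : ℕ → ℤ}
    (hc0 : c 0 = 1) (hc1 : c 1 = ap) :
    (mazurTateElement f p 0).eval₂ (algebraMap ℚ ℂ_[p]) 0 =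
      algebraMap ℚ ℂ_[p] (((c 1 - 2 * c 0 : ℤ) : ℚ) * ratPlusSymbol f 0) := by
  rw [eval₂_mazurTateElement_zero_at_zero hp2 hf0 hQ hpN hap, hc1, hc0]
  congr 1
  push_cast
  ring

/-- The constant coefficient of `θ_{n+1}` as a RATIONAL number: `θ_{n+1}(0) = e_{n+1}·[0]⁺_f` in `ℚ`.
[cite: MazurTateTeitelbaum1986Invent, §I.8 (8.6) and §I.10 Prop. (10.2)] -/
theorem eval_zero_mazurTateElement_succ (hp2 : p ≠ 2) (hf0 : IsNewform0 f)
    (hQ : coeffField f = ⊥) (hpN : ¬ p ∣ N) {ap : ℤ} (hap : cuspCoeff f p = ap) {c : ℕ → ℤ}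
    (hc0 : c 0 = 1) (hc1 : c 1 = ap) (hrec : ∀ j, c (j + 2) = ap * c (j + 1) - p * c j) (n : ℕ) :
    (mazurTateElement f p (n + 1)).eval 0 =
      ((c (n + 2) - 2 * c (n + 1) + c n : ℤ) : ℚ) * ratPlusSymbol f 0 := by
  have h := eval₂_mazurTateElement_succ_at_zero hp2 hf0 hQ hpN hap hc0 hc1 hrec n
  rw [eval₂_algebraMap_zero_eq] at h
  exact (algebraMap ℚ ℂ_[p]).injective h

end ClosedForm

/-! ## §3. The supersingular valuation pattern: `a_p = 0` and X8 closed forms -/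

section Supersingular

variable {N : ℕ} [NeZero N] {f : CuspForm (Gamma0 N) 2} {p : ℕ} [hp : Fact p.Prime]

/-- **`a_p = 0` (X6/X7; every supersingular `p ≥ 5`): the trivial-character column in closed form**,
`θ_{2i}(0) = −2(−p)^i·[0]⁺_f` and `θ_{2i+1}(0) = (1 − p)(−p)^i·[0]⁺_f` — so `θ_n(0)` is `[0]⁺_f`
times a `p`-adic unit times `p^{⌊n/2⌋}` (`p` odd). (`c_{2i} = (−p)^i`, `c_{2i+1} = 0`.)
[cite: MazurTateTeitelbaum1986Invent, §I.8 (8.6) and §I.10 Prop. (10.2)] [cite: Pollack2003, Prop. 6.9–6.10] -/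
theorem eval_zero_mazurTateElement_of_ap_eq_zero (hp2 : p ≠ 2) (hf0 : IsNewform0 f)
    (hQ : coeffField f = ⊥) (hpN : ¬ p ∣ N) (hap : cuspCoeff f p = ((0 : ℤ) : ℂ)) (i : ℕ) :
    (mazurTateElement f p (2 * i)).eval 0 = -2 * (-(p : ℚ)) ^ i * ratPlusSymbol f 0 ∧
      (mazurTateElement f p (2 * i + 1)).eval 0 = (1 - p) * (-(p : ℚ)) ^ i * ratPlusSymbol f 0 := by
  obtain ⟨c, hc0, hc1, hrec⟩ := exists_heckeDescentSeq 0 p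
  refine ⟨?_, ?_⟩
  · cases i with
    | zero =>
      have h := eval₂_mazurTateElement_zero_at_zero hp2 hf0 hQ hpN hap
      rw [eval₂_algebraMap_zero_eq] at h
      rw [Nat.mul_zero, (algebraMap ℚ ℂ_[p]).injective h]
      push_cast
      ring
    | succ i =>
      have key := eval_zero_mazurTateElement_succ hp2 hf0 hQ hpN hap hc0 hc1 hrec (2 * i + 1)
      rw [show 2 * i + 1 + 2 = 2 * i + 3 by ring, show 2 * i + 1 + 1 = 2 * i + 2 by ring,
        (heckeDescentSeq_secondDiff_of_ap_eq_zero hc0 hc1 hrec i).2] at key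
      rw [show 2 * (i + 1) = 2 * i + 1 + 1 by ring, key, pow_succ]
      push_cast
      ring
  · rw [eval_zero_mazurTateElement_succ hp2 hf0 hQ hpN hap hc0 hc1 hrec (2 * i),
      (heckeDescentSeq_secondDiff_of_ap_eq_zero hc0 hc1 hrec i).1]
    push_cast
    ring

/-- **X8 (`p = 3`, `a_3 = ±3`): the trivial-character column in closed form** —
`θ_n(0)/[0]⁺_f = a_3 − 2, 7 − 2a_3, 4a_3 − 12, 15 − 6a_3, 3a_3 − 18, −18` for `n = 0, …, 5`, i.e.
`(1, 1, 0, −3, −9, −18)` at `a_3 = 3` and `(−5, 13, −24, 33, −27, −18)` at `a_3 = −3`.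
[cite: MazurTateTeitelbaum1986Invent, §I.8 (8.6) and §I.10 Prop. (10.2)] -/
theorem eval_zero_mazurTateElement_of_three (hp3 : p = 3) (hf0 : IsNewform0 f)
    (hQ : coeffField f = ⊥) (hpN : ¬ p ∣ N) {a : ℤ} (ha : a ^ 2 = 9) (hap : cuspCoeff f p = a) :
    (mazurTateElement f p 0).eval 0 = ((a : ℚ) - 2) * ratPlusSymbol f 0 ∧
      (mazurTateElement f p 1).eval 0 = (7 - 2 * (a : ℚ)) * ratPlusSymbol f 0 ∧
      (mazurTateElement f p 2).eval 0 = (4 * (a : ℚ) - 12) * ratPlusSymbol f 0 ∧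
      (mazurTateElement f p 3).eval 0 = (15 - 6 * (a : ℚ)) * ratPlusSymbol f 0 ∧
      (mazurTateElement f p 4).eval 0 = (3 * (a : ℚ) - 18) * ratPlusSymbol f 0 ∧
      (mazurTateElement f p 5).eval 0 = -18 * ratPlusSymbol f 0 := by
  subst hp3
  have hp2 : (3 : ℕ) ≠ 2 := by decide
  obtain ⟨c, hc0, hc1, hrec⟩ := exists_heckeDescentSeq a 3
  obtain ⟨e1, e2, e3, e4, e5, -⟩ := heckeDescentSeq_secondDiff_values_of_three ha hc0 hc1 hrec
  have h0 := eval₂_mazurTateElement_zero_at_zero hp2 hf0 hQ hpN hap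
  rw [eval₂_algebraMap_zero_eq] at h0
  have hs := fun n ↦ eval_zero_mazurTateElement_succ hp2 hf0 hQ hpN hap hc0 hc1 hrec n
  refine ⟨(algebraMap ℚ ℂ_[3]).injective h0, ?_, ?_, ?_, ?_, ?_⟩
  · rw [hs 0, e1]; push_cast; ring
  · rw [hs 1, e2]; push_cast; ring
  · rw [hs 2, e3]; push_cast; ring
  · rw [hs 3, e4]; push_cast; ring
  · rw [hs 4, e5]; push_cast; ring

/-- **X8: the period-six law of the trivial-character column, `θ_{n+6}(0) = −27·θ_n(0)`**
(`α⁶ = −27` for the roots of `X² ∓ 3X + 3`). [cite: MazurTateTeitelbaum1986Invent, §I.10 Prop. (10.2)] -/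
theorem eval_zero_mazurTateElement_add_six_of_three (hp3 : p = 3) (hf0 : IsNewform0 f)
    (hQ : coeffField f = ⊥) (hpN : ¬ p ∣ N) {a : ℤ} (ha : a ^ 2 = 9) (hap : cuspCoeff f p = a)
    (n : ℕ) :
    (mazurTateElement f p (n + 6)).eval 0 = -27 * (mazurTateElement f p n).eval 0 := by
  subst hp3
  have hp2 : (3 : ℕ) ≠ 2 := by decide
  obtain ⟨c, hc0, hc1, hrec⟩ := exists_heckeDescentSeq a 3
  have hs := fun n ↦ eval_zero_mazurTateElement_succ hp2 hf0 hQ hpN hap hc0 hc1 hrec n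
  cases n with
  | zero =>
    obtain ⟨-, -, -, -, -, e6⟩ := heckeDescentSeq_secondDiff_values_of_three ha hc0 hc1 hrec
    rw [zero_add, (eval_zero_mazurTateElement_of_three rfl hf0 hQ hpN ha hap).1,
      show (6 : ℕ) = 5 + 1 by rfl, hs 5, e6]
    push_cast
    ring
  | succ n =>
    rw [show n + 1 + 6 = (n + 6) + 1 by ring, hs (n + 6), hs n,
      show n + 6 + 2 = n + 8 by ring, show n + 6 + 1 = n + 7 by ring,
      heckeDescentSeq_secondDiff_add_six_of_three ha hc0 hc1 hrec n]
    push_cast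
    ring

/-- X8: `θ_{6q+s}(0) = (−27)^q·θ_s(0)`. [cite: MazurTateTeitelbaum1986Invent, §I.10 Prop. (10.2)] -/
theorem eval_zero_mazurTateElement_six_mul_add_of_three (hp3 : p = 3) (hf0 : IsNewform0 f)
    (hQ : coeffField f = ⊥) (hpN : ¬ p ∣ N) {a : ℤ} (ha : a ^ 2 = 9) (hap : cuspCoeff f p = a)
    (q s : ℕ) :
    (mazurTateElement f p (6 * q + s)).eval 0 = (-27) ^ q * (mazurTateElement f p s).eval 0 := by
  induction q with
  | zero => rw [Nat.mul_zero, zero_add, pow_zero, one_mul]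
  | succ q ih =>
    rw [show 6 * (q + 1) + s = (6 * q + s) + 6 by ring,
      eval_zero_mazurTateElement_add_six_of_three hp3 hf0 hQ hpN ha hap, ih, pow_succ]
    ring

/-- **X8: the forced zero of gen 9 is the ONLY zero of the trivial-character column** — for
`L(f,1) ≠ 0`: `θ_n(0) = 0 ⟺ a_3 = 3 ∧ n ≡ 2 (mod 6)`. [cite: MazurTateTeitelbaum1986Invent, §I.10 Prop. (10.2)] -/
theorem eval_zero_mazurTateElement_eq_zero_iff_of_three (hp3 : p = 3) (hf0 : IsNewform0 f)
    (hQ : coeffField f = ⊥) (hpN : ¬ p ∣ N) {a : ℤ} (ha : a ^ 2 = 9) (hap : cuspCoeff f p = a)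
    (hr : ratPlusSymbol f 0 ≠ 0) (n : ℕ) :
    (mazurTateElement f p n).eval 0 = 0 ↔ a = 3 ∧ n % 6 = 2 := by
  have ha' : a = 3 ∨ a = -3 := by
    have h : (a - 3) * (a + 3) = 0 := by nlinarith [ha]
    rcases mul_eq_zero.mp h with h | h
    · left; linarith
    · right; linarith
  obtain ⟨h0, h1, h2, h3, h4, h5⟩ := eval_zero_mazurTateElement_of_three hp3 hf0 hQ hpN ha hap
  rw [← Nat.div_add_mod n 6, eval_zero_mazurTateElement_six_mul_add_of_three hp3 hf0 hQ hpN ha hap,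
    mul_eq_zero, or_iff_right (pow_ne_zero _ (by norm_num)), Nat.mul_add_mod_self_left,
    Nat.mod_mod]
  have hs : n % 6 < 6 := Nat.mod_lt n (by norm_num)
  generalize n % 6 = s at hs ⊢
  interval_cases s
  · rw [h0, mul_eq_zero, or_iff_left hr]
    constructor
    · intro h; rcases ha' with rfl | rfl <;> norm_num at h
    · rintro ⟨-, h⟩; omega
  · rw [h1, mul_eq_zero, or_iff_left hr]
    constructor
    · intro h; rcases ha' with rfl | rfl <;> norm_num at h
    · rintro ⟨-, h⟩; omega
  · rw [h2, mul_eq_zero, or_iff_left hr]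
    constructor
    · intro h
      rcases ha' with rfl | rfl
      · exact ⟨rfl, rfl⟩
      · norm_num at h
    · rintro ⟨rfl, -⟩; norm_num
  · rw [h3, mul_eq_zero, or_iff_left hr]
    constructor
    · intro h; rcases ha' with rfl | rfl <;> norm_num at h
    · rintro ⟨-, h⟩; omega
  · rw [h4, mul_eq_zero, or_iff_left hr]
    constructor
    · intro h; rcases ha' with rfl | rfl <;> norm_num at h
    · rintro ⟨-, h⟩; omega
  · rw [h5, mul_eq_zero, or_iff_left hr]
    constructor
    · intro h; norm_num at h
    · rintro ⟨-, h⟩; omega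

end Supersingular

end Summit.BirchSwinnertonDyer.Rank1Residual.Supersingular

end
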